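import Summits.QuantumFields.BalabanUV.Beta.FP.TorusCompositeObjectsG
import Summits.QuantumFields.BalabanUV.Beta.FP.TorusEffFormComposite
import Summits.QuantumFields.BalabanUV.Beta.FP.RelInvPeriodisedCombTorusLetters

/-!
# `BalabanUV.Beta.FP.TorusEffFormCompositeGB` — road «FP» for binder row D1, ROUTE T: **THE BOUNDED-BINDER RE-CUT («L5G-B») OF
# `FP/TorusEffFormCompositeG`** under the OWNER d1-p3 g34's ERRATUM E-FP-34-1 and RULING R-FP-76 (journal l.64955, 2026-08-25): (INV-m) ∧ (EFF-m) by
# one joint induction on the depth, generic over the one-step row family and the one-step fine form, the two one-step letters displayed — its ROOTED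
# and its (0.4)-SYMMETRISED instances — with the consecutive-levels clause stated ONLY ON THE STOREYS THE INDUCTION READS.

ERRATUM E-FP-34-1 (the OWNER, kernel-proved `HlevVacuous.not_forall_lev_succ`).  The binder `hlev : ∀ i, lev i = lev (i + 1) + 1` (`lev : ℕ → ℕ`)
displayed by `TorusEffFormComposite` (this lineage, gen 28), `TorusEffFormCompositeG` (gen 40) and the 24 tower-law files composed over them is
UNSATISFIABLE (`lev 0 = lev k + k` for every `k`, absurd at `k := lev 0 + 1`): those theorems are correct compositions BY NAME but vacuously true.
The ONLY use of `hlev` in the column is the induction below — `hlev 0` at each depth and the recursion `i ↦ i + 1` — i.e. exactly the BOUNDED clause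
`∀ i ≤ n, lev i = lev (i + 1) + 1` (`n + 1` = the number of steps), which IS satisfiable: `lev i := ℓ₀ + (n + 1 - i)` (§4, kernel `example`s).
R-FP-76 (a): the binder of record of every tower-law statement is `(hlev : ∀ i, i ≤ n → lev i = lev (i + 1) + 1)`; (b): this file FIRST (the root of
the re-cut; the road's bounded twins `<Name>B` of #19-G … #42a-Sym, `TowerUTopClosedSym`, `TowerKernelLawNamed` re-point their `open … (torus_composite_
inv_and_eff_G ∕ _sym)` here); (c) leaf-05 = author (first refusal exercised, journal [D1LEAF05-G48-MINE]); (d) the vacuous files STAY (append-only tree).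
THIS FILE = `TorusEffFormCompositeG` with that ONE token of every statement changed and the proofs verbatim but for `hlev 0 ↦ hlev 0 (Nat.zero_le _)`
and the recursion `fun i => hlev (i + 1) ↦ fun i hi => hlev (i + 1) (Nat.succ_le_succ hi)`; theorem NAMES are kept (the namespace is the `B` token),
§2's rooted consistency check is promoted from an `example` to the theorem `torus_composite_inv_and_eff` (= the bounded re-cut of gen 28's ROOTED
`TorusEffFormComposite.torus_composite_inv_and_eff`, so that no separate «L5-B» file is needed should a rooted consumer ever be re-cut), and §4 adds the
satisfiability leg R-FP-76 (d) asks X-readers for: the bounded binder instantiated in the kernel, and §3 APPLIED at an explicit level list (so the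
statements of this file are NOT vacuous).  `TorusEffFormCompositeG` is not imported (nothing of it is used); its three imports are.

WHAT.  `TorusEffFormComposite.torus_composite_inv_and_eff` (this lineage, gen 28) proves (vacuously, by E-FP-34-1), for leaf-06's ROOTED comb tower
(`compRows ∕ nestedSlice` over `Qstep`, i.e. over the rooted step kernel `bhKStepAt d (toSite r) Lc ℓ`), that the `(n+1)`-step composite sliced
system is (INV) non-degenerate and (EFF) has effective-form corner `(∏ i ∈ range (n+1), (wVH d Lc (lev i))⁻¹) •` the top level's field block —
by induction on the depth, closing at each storey by exactly TWO one-step letters: `h1` (the one-step comb-sliced fine system is non-degenerate,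
the OWNER's `NestedStepLawTorusInstance.torus_h1`) and `hId` (its effective corner is the next level's field block up to `(wVH (ℓ+1))⁻¹`,
this lineage's `RelInvPeriodisedEffFormCoarse.hId_order_zero_record`), plus the brick-free Schur-complement algebra of `EffFormTower` §2–§3 and the
OWNER's matrix-generic `NestedStepLawOneShot.det_kkt_compSliced_ne_zero`.  §1 re-runs THAT induction ONCE over leaf-06 g32's GENERIC tower
`compRowsG Lc Q ∕ nestedSliceG Lc Q` (`FP/TorusCompositeObjectsG`, `Q : StepRows d Lc` an abstract one-step row family) and an abstract
one-step fine-form kernel family `K : ℕ → (Fin (d+1) → ℕ) → MKer (d+1) (Fib d)` (level, root), with the two letters DISPLAYED as hypotheses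
indexed by the storey `k` (root `rs k`, level `lev k`, every torus `M′`):
`torus_composite_inv_and_eff_G` (here: with the bounded clause).  §2: at `Q := Qstep Lc`, `K ℓ r := bhKStepAt d (toSite r) Lc ℓ` the generic
theorem, fed `torus_h1 ∕ hId_order_zero_record` and read through leaf-06's bridges `compRows_eq_compRowsG ∕ nestedSlice_eq_nestedSliceG`, gives gen
28's rooted statement with the bounded clause: `torus_composite_inv_and_eff`.  §3 is the item the re-based tower consumes:
**`torus_composite_inv_and_eff_sym`** — the generic theorem at leaf-06's
`QSym ∕ QstepSym ∕ compRowsSym ∕ nestedSliceSym` (one-step rows over an1's shifted straight spread `bhKStepSh d Lc (Dsh Lc) ℓ`), `K ℓ _ :=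
bhKStepSh d Lc (Dsh Lc) ℓ`, at the CENTRED comb root `rs k := ctrOff (d+1) Lc` at every storey, fed this lineage's chart-(III′) torus letters
`RelInvPeriodisedCombTorusLetters.torus_h1_comb ∕ hId_comb` (which live at the centred root only: `relInv_GcombSh_bhKStepSh`).

WHY (located).  R-D1-g52-1 (3)(b): the composite tower is re-based on the (0.4)-symmetrised bricks at the centred root; (3)(c) → the OWNER: the
re-compositions #19(+Gen)∕#20∕#21 AFTER the suppliers' sym instances; R-FP-69 (b)∕(c): #19 `NestedStepLawTorusComposite` :209 (`have hIE :=
torus_composite_inv_and_eff …`), `…Gen`, #20 :272, #21 :214 (and leaf-06's `NestedDeadRowsOrderTwoTowerClosed` :120) consume (INV-m) ∧ (EFF-m)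
BY NAME, so its sym instance must exist before the first re-composed file; R-FP-76 (b): the (β1) END reads the sym column, whose bounded twins
are generated over THIS file.  Nothing landed is touched: gen 28's ∕ gen 40's theorems and their consumers stand (vacuous as stated, E-FP-34-1);
this file is a NEW sibling.  [folklore] Schur-complement bookkeeping BY NAME over OUR typed objects (leaf-06's towers, an1's ∕ an2's one-step
kernels); no `def`, no `def … : Prop`, nothing cited, 0 sorry, default heartbeats; nothing of the dictionary ∕ Bałaban's asserted, valued or
discharged — WHICH presentation the record's tower takes is the ROW's ruling, quoted, not adjudicated; 0 estimates; 0∕4 row-D1 binders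
(hW, hR, D1Tel, D1Rep); NOT (C1), NOT (T-ID), NOT SDF, NOT D1, NEVER «G-an2-4 closed», NOT BetaPertH, NOT continuum, NOT Clay.

HONEST DEPENDENCY (page 1, mandatory): continuum YM on T⁴ ⇐ BetaPertH ∧ nine spine estimates (0/9 proved); BetaPertH ⇐ (D1) ∧ (D4) ∧ CAP+tail;
G-an2-4 gates asym, D1 and NE2/3/4.  HONEST FRAMING (cell contract, verbatim): «discharging `BetaPertH` makes Bałaban's UV stability UNCONDITIONAL —
a real constructive-QFT result; it is NOT the continuum limit and NOT the Clay problem.»  ABSOLUTE RULE (cell charter, verbatim): «No internally-minted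
statement may enter as a cited fact. Every hypothesis is either kernel-proved in this package or a verbatim quotation of a PUBLISHED theorem with page
reference. The manuscript(s) under audit are NOT citable for their own disputed steps — they are the thing under adjudication; programme-internal
(2001/route/tribunal) claims are never citable.»  D1 formalisation swarm LEAF PROVER 05 (b2b-balaban-beta-d1-formalise-leaf-05 gen 48; §1–§3 =
gen 40's `TorusEffFormCompositeG` re-cut per R-FP-76), 2026-08-25.  No existing file touched.
-/

noncomputable section

open scoped BigOperators

namespace Summit.QuantumFields.BalabanUV.Beta.FP.TorusEffFormCompositeGB

open Matrix Finset
open Literature.MathematicalPhysics.QuantumFieldTheory.Balaban1983to89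
open Literature.MathematicalPhysics.QuantumFieldTheory.Balaban1983to89.Beta
open Literature.MathematicalPhysics.QuantumFieldTheory.Balaban1983to89.Beta.Composition (kkt)
open Literature.MathematicalPhysics.QuantumFieldTheory.Balaban1983to89.Beta.CompositionSingular (effForm)
open B5Prop11Plancherel (fine)
open B6Lemma24Torus (pbox)
open AffineAveraging (Site box toSite)
open AveragingContoursRooted (ctrOff)
open ExpKernelCalculus (MKer)
open OneStepResolventKernel (Fib)
open BalabanStepJetsSucc (wVH)
open Summit.QuantumFields.BalabanUV.Beta.BorderedHessian (bhKStepAt)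
open Summit.QuantumFields.BalabanUV.Beta.SymShiftedSpread (bhKStepSh)
open Summit.QuantumFields.BalabanUV.Beta.DshAn1 (Dsh)
open Summit.QuantumFields.BalabanUV.Beta.FP.KernelPeriodisationFib (Idx perF)
open Summit.QuantumFields.BalabanUV.Beta.FP.TorusGaugeCovarianceCoarse (coarsePt coarsePt_coe)
open Summit.QuantumFields.BalabanUV.Beta.FP.TorusCombRows (Res combRowsT)
open Summit.QuantumFields.BalabanUV.Beta.FP.TorusCompositeObjects (towerTorus Qstep combF compRows nestedSlice)
open Summit.QuantumFields.BalabanUV.Beta.FP.TorusCompositeObjectsG (StepRows compRowsG nestedSliceG compRowsG_succ compRowsG_one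
  nestedSliceG_succ QstepSym QSym compRowsSym nestedSliceSym compRows_eq_compRowsG nestedSlice_eq_nestedSliceG)
open Summit.QuantumFields.BalabanUV.Beta.FP.EffFormTower (effForm_nested_corner_assoc effForm_smul_form_toBlocks₁₁ det_kkt_fromRows_assoc)
open Summit.QuantumFields.BalabanUV.Beta.FP.RelInvPeriodisedEffFormCoarse (hId_order_zero_record wVH_pos)
open Summit.QuantumFields.BalabanUV.Beta.FP.RelInvPeriodisedCoarse (det_kkt_smul_form_ne_zero_iff)
open Summit.QuantumFields.BalabanUV.Beta.FP.NestedStepLawTorusInstance (torus_h1 coarseSlot_injective coarseSlot_range)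
open Summit.QuantumFields.BalabanUV.Beta.FP.NestedStepLawOneShot (det_kkt_compSliced_ne_zero)
open Summit.QuantumFields.BalabanUV.Beta.FP.RelInvPeriodisedCombTorusLetters (torus_h1_comb hId_comb)

variable {d : ℕ} (Lc : ℕ) [NeZero Lc]

/-! ## §1 (INV-m) ∧ (EFF-m) for the generic tower, the two one-step letters displayed -/

set_option synthInstance.maxSize 1024 in
/-- **[folklore] (INV-m) ∧ (EFF-m) FOR THE GENERIC TOWER, JOINTLY, BY INDUCTION ON THE DEPTH WITH THE TOP TORUS GENERALISED.**  Data: an abstract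
one-step row family `Q : StepRows d Lc` (leaf-06's `compRowsG ∕ nestedSliceG` build the tower from it) and an abstract one-step FINE-FORM kernel
family `K ℓ r : MKer (d+1) (Fib d)` (level `ℓ`, root `r`; only its field–field block, periodised, is read).  For a top torus `M`, a level sequence
`lev` CONSECUTIVE ON THE STOREYS READ (`lev i = lev (i+1) + 1` for `i ≤ n` — R-FP-76 (a); the unbounded `∀ i` of gen 28 ∕ gen 40 is unsatisfiable,
E-FP-34-1) and a root sequence `rs`, ASSUME the two one-step letters at every storey `k` and on every
torus `M′`: (h1)ₖ the one-step comb-sliced fine system `(𝓚(fine Lc M′, lev k, rs k) ; [Q M′ (lev k) (rs k); combF Lc (fine Lc M′) (rs k)])` is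
non-degenerate, and (hId)ₖ its effective-form corner is `(wVH d Lc (lev k + 1))⁻¹ • 𝓚(M′, lev k + 1, r′)` for every root `r′` — writing
`𝓚(T, ℓ, r)` IN PROSE ONLY for `(perF T (K ℓ r)).submatrix (inl) (inl)` (spelled out in the signature; no notation is declared).  THEN the
`(n+1)`-step composite sliced system `(𝓚(towerTorus Lc M (n+1), lev (n+1), rs (n+1)) ; [compRowsG Lc Q M lev rs (n+1); nestedSliceG Lc Q (fine Lc M)
(lev ∘ succ) (rs ∘ succ) n])` has (i) a non-degenerate bordered matrix and (ii) effective-form corner `(∏ i ∈ range (n+1), (wVH d Lc (lev i))⁻¹) •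
𝓚(M, lev 0, r′)` for every `r′`.  (Gen 28's proof verbatim with `Qstep ↦ Q`, `compRows ↦ compRowsG Lc Q`, `nestedSlice ↦ nestedSliceG Lc Q`,
`torus_h1 ↦ (h1)₁`, `hId_order_zero_record ↦ (hId)₁`; the induction hypothesis is the tower below `M` with the sequences shifted by one — the bounded
clause at depth `n + 1` restricts to the bounded clause at depth `n` for `lev ∘ succ` by `Nat.succ_le_succ`, and `hlev 0` is read at `0 ≤ n`.) -/
theorem torus_composite_inv_and_eff_G (Q : StepRows d Lc) (K : ℕ → (Fin (d + 1) → ℕ) → MKer (d + 1) (Fib d)) (n : ℕ) :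
    ∀ (M : Fin (d + 1) → ℕ) [∀ μ, NeZero (M μ)] (lev : ℕ → ℕ) (rs : ℕ → (Fin (d + 1) → ℕ)),
      (∀ i, i ≤ n → lev i = lev (i + 1) + 1) →
      (∀ (k : ℕ) (M' : Fin (d + 1) → ℕ) [∀ μ, NeZero (M' μ)],
        (kkt ((perF (fine Lc M') (K (lev k) (rs k))).submatrix
              (fun b : ↥(pbox (fine Lc M')) × Fin (d + 1) => ((b.1, Sum.inl b.2) : Idx (fine Lc M') (Fib d)))
              (fun b : ↥(pbox (fine Lc M')) × Fin (d + 1) => ((b.1, Sum.inl b.2) : Idx (fine Lc M') (Fib d))))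
          (fromRows (Q M' (lev k) (rs k)) (combF Lc (fine Lc M') (rs k)))).det ≠ 0) →
      (∀ (k : ℕ) (M' : Fin (d + 1) → ℕ) [∀ μ, NeZero (M' μ)] (r' : Fin (d + 1) → ℕ),
        (effForm ((perF (fine Lc M') (K (lev k) (rs k))).submatrix
              (fun b : ↥(pbox (fine Lc M')) × Fin (d + 1) => ((b.1, Sum.inl b.2) : Idx (fine Lc M') (Fib d)))
              (fun b : ↥(pbox (fine Lc M')) × Fin (d + 1) => ((b.1, Sum.inl b.2) : Idx (fine Lc M') (Fib d))))
            (fromRows (Q M' (lev k) (rs k)) (combF Lc (fine Lc M') (rs k)))).toBlocks₁₁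
          = (wVH d Lc (lev k + 1))⁻¹ • (perF M' (K (lev k + 1) r')).submatrix
              (fun b : ↥(pbox M') × Fin (d + 1) => ((b.1, Sum.inl b.2) : Idx M' (Fib d)))
              (fun b : ↥(pbox M') × Fin (d + 1) => ((b.1, Sum.inl b.2) : Idx M' (Fib d)))) →
      (kkt ((perF (towerTorus Lc M (n + 1)) (K (lev (n + 1)) (rs (n + 1)))).submatrix
          (fun b : ↥(pbox (towerTorus Lc M (n + 1))) × Fin (d + 1) => ((b.1, Sum.inl b.2) : Idx (towerTorus Lc M (n + 1)) (Fib d)))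
          (fun b : ↥(pbox (towerTorus Lc M (n + 1))) × Fin (d + 1) => ((b.1, Sum.inl b.2) : Idx (towerTorus Lc M (n + 1)) (Fib d))))
          (fromRows (compRowsG Lc Q M lev rs (n + 1)) (nestedSliceG Lc Q (fine Lc M) (fun k => lev (k + 1)) (fun k => rs (k + 1)) n))).det ≠ 0
      ∧ ∀ r' : Fin (d + 1) → ℕ,
        (effForm ((perF (towerTorus Lc M (n + 1)) (K (lev (n + 1)) (rs (n + 1)))).submatrix
          (fun b : ↥(pbox (towerTorus Lc M (n + 1))) × Fin (d + 1) => ((b.1, Sum.inl b.2) : Idx (towerTorus Lc M (n + 1)) (Fib d)))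
          (fun b : ↥(pbox (towerTorus Lc M (n + 1))) × Fin (d + 1) => ((b.1, Sum.inl b.2) : Idx (towerTorus Lc M (n + 1)) (Fib d))))
            (fromRows (compRowsG Lc Q M lev rs (n + 1)) (nestedSliceG Lc Q (fine Lc M) (fun k => lev (k + 1)) (fun k => rs (k + 1)) n))).toBlocks₁₁
          = (∏ i ∈ range (n + 1), (wVH d Lc (lev i))⁻¹) • ((perF M (K (lev 0) r')).submatrix
          (fun b : ↥(pbox M) × Fin (d + 1) => ((b.1, Sum.inl b.2) : Idx M (Fib d)))
          (fun b : ↥(pbox M) × Fin (d + 1) => ((b.1, Sum.inl b.2) : Idx M (Fib d)))) := by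
  induction n with
  | zero =>
    intro M _ lev rs hlev hH1 hId
    have e1 : compRowsG Lc Q M lev rs (0 + 1) = Q M (lev 1) (rs 1) := compRowsG_one Lc Q M lev rs
    have h01 : lev 0 = lev 1 + 1 := hlev 0 (Nat.zero_le 0)
    refine ⟨?_, fun r' => ?_⟩
    · rw [e1]
      exact hH1 1 M
    · rw [e1, Finset.prod_range_one, h01]
      exact hId 1 M r'
  | succ n ih =>
    intro M _ lev rs hlev hH1 hId
    -- the tower below `M`: top torus `fine Lc M`, sequences shifted by one, letters shifted by one
    obtain ⟨ihInv, ihEff⟩ := ih (fine Lc M) (fun k => lev (k + 1)) (fun k => rs (k + 1))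
      (fun i hi => hlev (i + 1) (Nat.succ_le_succ hi))
      (fun k M' _ => hH1 (k + 1) M') (fun k M' _ r' => hId (k + 1) M' r')
    have hL0 : 0 < Lc := Nat.pos_of_ne_zero (NeZero.ne Lc)
    -- the constant of the tower below, and its non-vanishing
    have hc : (∏ i ∈ range (n + 1), (wVH d Lc (lev (i + 1)))⁻¹) ≠ 0 :=
      Finset.prod_ne_zero_iff.2 fun i _ => inv_ne_zero (wVH_pos (d := d) hL0 _).ne'
    -- (EFF) of the tower below, read with the top root `rs 1`: its effective corner IS the top step's fine form, scaled
    have hE := ihEff (rs 1)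
    -- the top step's fine system is non-degenerate ((h1)₁), hence so is its scaled copy
    have h1top := hH1 1 M
    have h2 : (kkt ((effForm ((perF (towerTorus Lc (fine Lc M) (n + 1)) (K (lev (n + 1 + 1)) (rs (n + 1 + 1)))).submatrix
          (fun b : ↥(pbox (towerTorus Lc (fine Lc M) (n + 1))) × Fin (d + 1) => ((b.1, Sum.inl b.2) : Idx (towerTorus Lc (fine Lc M) (n + 1)) (Fib d)))
          (fun b : ↥(pbox (towerTorus Lc (fine Lc M) (n + 1))) × Fin (d + 1) => ((b.1, Sum.inl b.2) : Idx (towerTorus Lc (fine Lc M) (n + 1)) (Fib d))))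
        (fromRows (compRowsG Lc Q (fine Lc M) (fun k => lev (k + 1)) (fun k => rs (k + 1)) (n + 1))
          (nestedSliceG Lc Q (fine Lc (fine Lc M)) (fun k => lev (k + 1 + 1)) (fun k => rs (k + 1 + 1)) n))).toBlocks₁₁)
        (fromRows (Q M (lev 1) (rs 1)) (combF Lc (fine Lc M) (rs 1)))).det ≠ 0 := by
      rw [hE]
      exact (det_kkt_smul_form_ne_zero_iff hc _ _).2 h1top
    refine ⟨?_, fun r' => ?_⟩
    · -- (INV) at depth n+2: the OWNER's `det_kkt_compSliced_ne_zero` at `G := 0`, re-associated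
      have h := det_kkt_compSliced_ne_zero _ (compRowsG Lc Q (fine Lc M) (fun k => lev (k + 1)) (fun k => rs (k + 1)) (n + 1))
        (Q M (lev 1) (rs 1)) 0 _ (combF Lc (fine Lc M) (rs 1)) rfl ihInv (by rw [add_zero]; exact h2)
      rw [Matrix.mul_zero, Matrix.zero_mul, add_zero, ← det_kkt_fromRows_assoc] at h
      rw [nestedSliceG_succ, compRowsG_succ]
      exact h
    · -- (EFF) at depth n+2: tower (`EffFormTower`), then scaling, then the top step's (hId)₁
      have key := effForm_nested_corner_assoc _ _ _ (Q M (lev 1) (rs 1)) (combF Lc (fine Lc M) (rs 1))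
        (isUnit_iff_ne_zero.2 ihInv) (isUnit_iff_ne_zero.2 h2)
      rw [nestedSliceG_succ, compRowsG_succ Lc Q M lev rs (n + 1)]
      -- restate the goal in the syntactic shape of the tower below (`towerTorus Lc M (n+2) = towerTorus Lc (fine Lc M) (n+1)` by `rfl`)
      show (effForm ((perF (towerTorus Lc (fine Lc M) (n + 1)) (K (lev (n + 1 + 1)) (rs (n + 1 + 1)))).submatrix
          (fun b : ↥(pbox (towerTorus Lc (fine Lc M) (n + 1))) × Fin (d + 1) => ((b.1, Sum.inl b.2) : Idx (towerTorus Lc (fine Lc M) (n + 1)) (Fib d)))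
          (fun b : ↥(pbox (towerTorus Lc (fine Lc M) (n + 1))) × Fin (d + 1) => ((b.1, Sum.inl b.2) : Idx (towerTorus Lc (fine Lc M) (n + 1)) (Fib d))))
          (fromRows (Q M (lev 1) (rs 1) * compRowsG Lc Q (fine Lc M) (fun k => lev (k + 1)) (fun k => rs (k + 1)) (n + 1))
            (fromRows (combF Lc (fine Lc M) (rs 1) * compRowsG Lc Q (fine Lc M) (fun k => lev (k + 1)) (fun k => rs (k + 1)) (n + 1))
              (nestedSliceG Lc Q (fine Lc (fine Lc M)) (fun k => lev (k + 1 + 1)) (fun k => rs (k + 1 + 1)) n)))).toBlocks₁₁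
        = (∏ i ∈ range (n + 1 + 1), (wVH d Lc (lev i))⁻¹) • ((perF M (K (lev 0) r')).submatrix
          (fun b : ↥(pbox M) × Fin (d + 1) => ((b.1, Sum.inl b.2) : Idx M (Fib d)))
          (fun b : ↥(pbox M) × Fin (d + 1) => ((b.1, Sum.inl b.2) : Idx M (Fib d))))
      rw [key, hE]
      rw [Nat.zero_add, effForm_smul_form_toBlocks₁₁ hc _ _ _ (isUnit_iff_ne_zero.2 h1top), hId 1 M r', smul_smul, ← hlev 0 (Nat.zero_le _),
        Finset.prod_range_succ' _ (n + 1)]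

/-! ## §2 The rooted instance: at `Q := Qstep Lc`, `K ℓ r := bhKStepAt d (toSite r) Lc ℓ` the generic theorem is gen 28's rooted statement, bounded -/

set_option synthInstance.maxSize 1024 in
/-- **[folklore] (INV-m) ∧ (EFF-m) FOR THE ROOTED COMB TOWER, BOUNDED BINDER** — the ROOTED instance of §1, fed the OWNER's `torus_h1` and this
lineage's `hId_order_zero_record` at the in-box roots `rs k` and read through leaf-06's bridges `compRows_eq_compRowsG ∕ nestedSlice_eq_nestedSliceG`:
the statement of gen 28's `TorusEffFormComposite.torus_composite_inv_and_eff` with its unsatisfiable `∀ i, lev i = lev (i + 1) + 1` (E-FP-34-1)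
replaced by the bounded clause of R-FP-76 (a); same explicit-argument order (`Lc n M lev rs hlev hrs`), so a re-cut rooted consumer (#19 ∕ Gen ∕ #20 ∕
#21 ∕ leaf-06's `…TowerClosed`, re-cut only if ever needed, R-FP-76 (c)) re-points its `open` here and keeps its call.  In gen 40's file this was an
`example`; it is named here so that no separate rooted «L5-B» file is needed. -/
theorem torus_composite_inv_and_eff (n : ℕ) (M : Fin (d + 1) → ℕ) [∀ μ, NeZero (M μ)] (lev : ℕ → ℕ) (rs : ℕ → (Fin (d + 1) → ℕ))
    (hlev : ∀ i, i ≤ n → lev i = lev (i + 1) + 1) (hrs : ∀ i, rs i ∈ box (d + 1) Lc) :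
    (kkt ((perF (towerTorus Lc M (n + 1)) (bhKStepAt d (toSite (rs (n + 1))) Lc (lev (n + 1)))).submatrix
          (fun b : ↥(pbox (towerTorus Lc M (n + 1))) × Fin (d + 1) => ((b.1, Sum.inl b.2) : Idx (towerTorus Lc M (n + 1)) (Fib d)))
          (fun b : ↥(pbox (towerTorus Lc M (n + 1))) × Fin (d + 1) => ((b.1, Sum.inl b.2) : Idx (towerTorus Lc M (n + 1)) (Fib d))))
          (fromRows (compRows Lc M lev rs (n + 1)) (nestedSlice Lc (fine Lc M) (fun k => lev (k + 1)) (fun k => rs (k + 1)) n))).det ≠ 0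
      ∧ ∀ r' : Fin (d + 1) → ℕ,
        (effForm ((perF (towerTorus Lc M (n + 1)) (bhKStepAt d (toSite (rs (n + 1))) Lc (lev (n + 1)))).submatrix
          (fun b : ↥(pbox (towerTorus Lc M (n + 1))) × Fin (d + 1) => ((b.1, Sum.inl b.2) : Idx (towerTorus Lc M (n + 1)) (Fib d)))
          (fun b : ↥(pbox (towerTorus Lc M (n + 1))) × Fin (d + 1) => ((b.1, Sum.inl b.2) : Idx (towerTorus Lc M (n + 1)) (Fib d))))
            (fromRows (compRows Lc M lev rs (n + 1)) (nestedSlice Lc (fine Lc M) (fun k => lev (k + 1)) (fun k => rs (k + 1)) n))).toBlocks₁₁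
          = (∏ i ∈ range (n + 1), (wVH d Lc (lev i))⁻¹) • ((perF M (bhKStepAt d (toSite (r')) Lc (lev 0))).submatrix
          (fun b : ↥(pbox M) × Fin (d + 1) => ((b.1, Sum.inl b.2) : Idx M (Fib d)))
          (fun b : ↥(pbox M) × Fin (d + 1) => ((b.1, Sum.inl b.2) : Idx M (Fib d)))) := by
  rw [compRows_eq_compRowsG, nestedSlice_eq_nestedSliceG]
  exact torus_composite_inv_and_eff_G Lc (fun M _ ℓ r => Qstep Lc M ℓ r) (fun ℓ r => bhKStepAt d (toSite r) Lc ℓ) n M lev rs hlev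
    (fun k M' _ => torus_h1 M' (hrs k) (lev k))
    (fun k M' _ r' => hId_order_zero_record M' (hrs k) (lev k) r' (coarsePt M' Lc) (coarsePt_coe M' Lc) (coarseSlot_injective M')
      (coarseSlot_range M'))

/-! ## §3 The (0.4)-symmetrised instance at the centred comb root — the object the re-based tower consumes -/

set_option synthInstance.maxSize 1024 in
/-- **[folklore] (INV-m) ∧ (EFF-m) FOR THE (0.4)-SYMMETRISED COMB TOWER, BOUNDED BINDER** (R-D1-g52-1 (β1); the sym twin of §2 that the
re-composed sym column reads at its place — R-FP-76 (b): the bounded twins of #19-G, GenG, #20-G, #21-G, #19-Sym, (6), #41c-G∕-Sym, #41d-G∕-Sym,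
#42a-Sym, `TowerUTopClosedSym`, `TowerKernelLawNamed` re-point `open …TorusEffFormCompositeG (…)` to this namespace, names unchanged; the clause
`∀ i ≤ n` is exactly what they pass through): for leaf-06's `compRowsSym ∕ nestedSliceSym`
(one-step rows `QstepSym` over an1's shifted straight spread `𝕄_ℓ = bhKStepSh d Lc (Dsh Lc) ℓ`) at the CENTRED comb root `ctrOff (d+1) Lc` at every
storey, with the fine forms the field blocks of `𝕄_ℓ` periodised, the `(n+1)`-step composite sliced system is (INV) non-degenerate and (EFF) has
effective-form corner `(∏ i ∈ range (n+1), (wVH d Lc (lev i))⁻¹) •` the field block of `𝕄_{lev 0}` periodised on `M` — §1 fed this lineage's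
chart-(III′) torus letters `torus_h1_comb ∕ hId_comb` (centred root only; the kernel is root-free, so no `r′` remains on the right). -/
theorem torus_composite_inv_and_eff_sym (n : ℕ) (M : Fin (d + 1) → ℕ) [∀ μ, NeZero (M μ)] (lev : ℕ → ℕ)
    (hlev : ∀ i, i ≤ n → lev i = lev (i + 1) + 1) :
    (kkt ((perF (towerTorus Lc M (n + 1)) (bhKStepSh d Lc (Dsh Lc) (lev (n + 1)))).submatrix
          (fun b : ↥(pbox (towerTorus Lc M (n + 1))) × Fin (d + 1) => ((b.1, Sum.inl b.2) : Idx (towerTorus Lc M (n + 1)) (Fib d)))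
          (fun b : ↥(pbox (towerTorus Lc M (n + 1))) × Fin (d + 1) => ((b.1, Sum.inl b.2) : Idx (towerTorus Lc M (n + 1)) (Fib d))))
          (fromRows (compRowsSym Lc M lev (fun _ => ctrOff (d + 1) Lc) (n + 1))
            (nestedSliceSym Lc (fine Lc M) (fun k => lev (k + 1)) (fun _ => ctrOff (d + 1) Lc) n))).det ≠ 0
      ∧ (effForm ((perF (towerTorus Lc M (n + 1)) (bhKStepSh d Lc (Dsh Lc) (lev (n + 1)))).submatrix
          (fun b : ↥(pbox (towerTorus Lc M (n + 1))) × Fin (d + 1) => ((b.1, Sum.inl b.2) : Idx (towerTorus Lc M (n + 1)) (Fib d)))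
          (fun b : ↥(pbox (towerTorus Lc M (n + 1))) × Fin (d + 1) => ((b.1, Sum.inl b.2) : Idx (towerTorus Lc M (n + 1)) (Fib d))))
            (fromRows (compRowsSym Lc M lev (fun _ => ctrOff (d + 1) Lc) (n + 1))
              (nestedSliceSym Lc (fine Lc M) (fun k => lev (k + 1)) (fun _ => ctrOff (d + 1) Lc) n))).toBlocks₁₁
          = (∏ i ∈ range (n + 1), (wVH d Lc (lev i))⁻¹) • ((perF M (bhKStepSh d Lc (Dsh Lc) (lev 0))).submatrix
          (fun b : ↥(pbox M) × Fin (d + 1) => ((b.1, Sum.inl b.2) : Idx M (Fib d)))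
          (fun b : ↥(pbox M) × Fin (d + 1) => ((b.1, Sum.inl b.2) : Idx M (Fib d)))) := by
  have h := torus_composite_inv_and_eff_G Lc (QSym Lc) (fun ℓ _ => bhKStepSh d Lc (Dsh Lc) ℓ) n M lev
    (fun _ => ctrOff (d + 1) Lc) hlev (fun k M' _ => torus_h1_comb M' (lev k)) (fun k M' _ _ => hId_comb M' (lev k))
  exact ⟨h.1, h.2 (ctrOff (d + 1) Lc)⟩

/-! ## §4 The satisfiability leg (R-FP-76 (d)): the bounded binder is inhabited, and §2 ∕ §3 APPLY at an explicit level list -/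

/-- [bookkeeping] **THE BOUNDED BINDER IS SATISFIABLE**: the level list `lev i := ℓ₀ + (n + 1 - i)` — top level `ℓ₀ + (n + 1)`, bottom level
`lev (n + 1) = ℓ₀`, the record's «`lev k = j + m - k`» of gen 28's docstring read with `m = n + 1`, `j = ℓ₀` — is consecutive on every storey
`i ≤ n` (and, by E-FP-34-1, NO list is consecutive at every `i : ℕ`).  `omega` over truncated subtraction. -/
theorem levels_consecutive_on_storeys (ℓ₀ n : ℕ) : ∀ i, i ≤ n → ℓ₀ + (n + 1 - i) = ℓ₀ + (n + 1 - (i + 1)) + 1 := by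
  intro i hi
  omega

/-- [bookkeeping, the X-read leg of R-FP-76 (d) in the kernel] the unbounded binder of gen 28 ∕ gen 40 is NOT satisfiable — the OWNER's
`HlevVacuous.not_forall_lev_succ`, re-proved here in two lines so that the contrast with `levels_consecutive_on_storeys` is on the page: from
`∀ i, lev i = lev (i + 1) + 1` one gets `lev 0 = lev k + k` for every `k`, absurd at `k := lev 0 + 1`. -/
theorem not_forall_levels_consecutive (lev : ℕ → ℕ) : ¬ ∀ i, lev i = lev (i + 1) + 1 := by
  intro h
  have key : ∀ k, lev 0 = lev k + k := by
    intro k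
    induction k with
    | zero => omega
    | succ k ih => rw [ih, h k]; omega
  have := key (lev 0 + 1)
  omega

set_option synthInstance.maxSize 1024 in
/-- [bookkeeping] **§3 IS NOT VACUOUS**: at the explicit level list `lev i := ℓ₀ + (n + 1 - i)` the (0.4)-symmetrised tower theorem holds with NO
level hypothesis left — (INV-m) ∧ (EFF-m) for the `(n+1)`-step sym comb tower run from level `ℓ₀ + (n + 1)` (top torus `M`) down to level `ℓ₀`. -/
theorem torus_composite_inv_and_eff_sym_levels (ℓ₀ n : ℕ) (M : Fin (d + 1) → ℕ) [∀ μ, NeZero (M μ)] :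
    (kkt ((perF (towerTorus Lc M (n + 1)) (bhKStepSh d Lc (Dsh Lc) (ℓ₀ + (n + 1 - (n + 1))))).submatrix
          (fun b : ↥(pbox (towerTorus Lc M (n + 1))) × Fin (d + 1) => ((b.1, Sum.inl b.2) : Idx (towerTorus Lc M (n + 1)) (Fib d)))
          (fun b : ↥(pbox (towerTorus Lc M (n + 1))) × Fin (d + 1) => ((b.1, Sum.inl b.2) : Idx (towerTorus Lc M (n + 1)) (Fib d))))
          (fromRows (compRowsSym Lc M (fun i => ℓ₀ + (n + 1 - i)) (fun _ => ctrOff (d + 1) Lc) (n + 1))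
            (nestedSliceSym Lc (fine Lc M) (fun k => ℓ₀ + (n + 1 - (k + 1))) (fun _ => ctrOff (d + 1) Lc) n))).det ≠ 0
      ∧ (effForm ((perF (towerTorus Lc M (n + 1)) (bhKStepSh d Lc (Dsh Lc) (ℓ₀ + (n + 1 - (n + 1))))).submatrix
          (fun b : ↥(pbox (towerTorus Lc M (n + 1))) × Fin (d + 1) => ((b.1, Sum.inl b.2) : Idx (towerTorus Lc M (n + 1)) (Fib d)))
          (fun b : ↥(pbox (towerTorus Lc M (n + 1))) × Fin (d + 1) => ((b.1, Sum.inl b.2) : Idx (towerTorus Lc M (n + 1)) (Fib d))))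
            (fromRows (compRowsSym Lc M (fun i => ℓ₀ + (n + 1 - i)) (fun _ => ctrOff (d + 1) Lc) (n + 1))
              (nestedSliceSym Lc (fine Lc M) (fun k => ℓ₀ + (n + 1 - (k + 1))) (fun _ => ctrOff (d + 1) Lc) n))).toBlocks₁₁
          = (∏ i ∈ range (n + 1), (wVH d Lc (ℓ₀ + (n + 1 - i)))⁻¹) • ((perF M (bhKStepSh d Lc (Dsh Lc) (ℓ₀ + (n + 1 - 0)))).submatrix
          (fun b : ↥(pbox M) × Fin (d + 1) => ((b.1, Sum.inl b.2) : Idx M (Fib d)))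
          (fun b : ↥(pbox M) × Fin (d + 1) => ((b.1, Sum.inl b.2) : Idx M (Fib d)))) :=
  torus_composite_inv_and_eff_sym Lc n M (fun i => ℓ₀ + (n + 1 - i)) (levels_consecutive_on_storeys ℓ₀ n)

set_option synthInstance.maxSize 1024 in
/-- [bookkeeping] **§2 IS NOT VACUOUS** either: the rooted tower theorem at the level list `lev i := ℓ₀ + (n + 1 - i)` and any in-box root
sequence `rs` — only the root hypothesis `hrs` remains. -/
theorem torus_composite_inv_and_eff_levels (ℓ₀ n : ℕ) (M : Fin (d + 1) → ℕ) [∀ μ, NeZero (M μ)] (rs : ℕ → (Fin (d + 1) → ℕ))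
    (hrs : ∀ i, rs i ∈ box (d + 1) Lc) :
    (kkt ((perF (towerTorus Lc M (n + 1)) (bhKStepAt d (toSite (rs (n + 1))) Lc (ℓ₀ + (n + 1 - (n + 1))))).submatrix
          (fun b : ↥(pbox (towerTorus Lc M (n + 1))) × Fin (d + 1) => ((b.1, Sum.inl b.2) : Idx (towerTorus Lc M (n + 1)) (Fib d)))
          (fun b : ↥(pbox (towerTorus Lc M (n + 1))) × Fin (d + 1) => ((b.1, Sum.inl b.2) : Idx (towerTorus Lc M (n + 1)) (Fib d))))
          (fromRows (compRows Lc M (fun i => ℓ₀ + (n + 1 - i)) rs (n + 1))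
            (nestedSlice Lc (fine Lc M) (fun k => ℓ₀ + (n + 1 - (k + 1))) (fun k => rs (k + 1)) n))).det ≠ 0
      ∧ ∀ r' : Fin (d + 1) → ℕ,
        (effForm ((perF (towerTorus Lc M (n + 1)) (bhKStepAt d (toSite (rs (n + 1))) Lc (ℓ₀ + (n + 1 - (n + 1))))).submatrix
          (fun b : ↥(pbox (towerTorus Lc M (n + 1))) × Fin (d + 1) => ((b.1, Sum.inl b.2) : Idx (towerTorus Lc M (n + 1)) (Fib d)))
          (fun b : ↥(pbox (towerTorus Lc M (n + 1))) × Fin (d + 1) => ((b.1, Sum.inl b.2) : Idx (towerTorus Lc M (n + 1)) (Fib d))))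
            (fromRows (compRows Lc M (fun i => ℓ₀ + (n + 1 - i)) rs (n + 1))
              (nestedSlice Lc (fine Lc M) (fun k => ℓ₀ + (n + 1 - (k + 1))) (fun k => rs (k + 1)) n))).toBlocks₁₁
          = (∏ i ∈ range (n + 1), (wVH d Lc (ℓ₀ + (n + 1 - i)))⁻¹) • ((perF M (bhKStepAt d (toSite (r')) Lc (ℓ₀ + (n + 1 - 0)))).submatrix
          (fun b : ↥(pbox M) × Fin (d + 1) => ((b.1, Sum.inl b.2) : Idx M (Fib d)))
          (fun b : ↥(pbox M) × Fin (d + 1) => ((b.1, Sum.inl b.2) : Idx M (Fib d)))) :=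
  torus_composite_inv_and_eff Lc n M (fun i => ℓ₀ + (n + 1 - i)) rs (levels_consecutive_on_storeys ℓ₀ n) hrs

end Summit.QuantumFields.BalabanUV.Beta.FP.TorusEffFormCompositeGB

end
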